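import Summits.QuantumAdvantage.QuantumAdvantage.Theorems.CharDialExchangeBridge
import Mathlib.Algebra.Group.ForwardDiff
import Mathlib.Data.Nat.Choose.Lucas
import HarnessLib

/-!
# TransferDial A — BOOLEANITY KILLS THE SECOND DIGIT: a big exchangeable block is `p`-periodic at degree `≤ 2p − 3`

`block_periodic_two`: if a Boolean `f` on `{0,1}^n` has `𝔽_p`-degree `≤ 2p − 3` (`p ≥ 3`) and is invariant under all
transpositions of a set `X` of `≥ 3p − 1` coordinates, then `f` depends on `u|_X` only through `wt_X(u) mod p`.
Mechanism (symmetrisation-free): the layer profile `g(w)` of `f` above a fixed outside pattern has `(2p−2)`-nd forward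
difference `0` (Möbius coefficients of order `> 2p − 3` vanish, `SubLog.moeb_eq_zero_of_mem_lowDeg`), so by Gregory–Newton
(`shift_eq_sum_fwdDiff_iter`) `g(w) = Σ_{e ≤ 2p−3} Δ^e g(0)·C(w,e)`; one base-`p` digit of Lucas splits this as
`A(w mod p) + (w div p)·B(w mod p)` in `𝔽_p`, and Booleanity at `w₀, w₀+p, w₀+2p` (available since `|X| ≥ 3p − 1`) forces `B = 0`.
`shadow_blocks`: the multi-block corollary — a cut symmetric inside each block (all blocks `≥ 3p − 1`) of a block map
`b : Fin m → Option (Fin r)` depends only on the free coordinates and the block weights mod `p`.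
Main names: `cast_choose_lucas`, `fwdDiff_iter_zero_of_le`, `newton_trunc`, `two_digit`, `second_digit_zero`, `seq_periodic`,
`block_periodic_two`, `blockOf`, `shadow_blocks`.

Tree twin, part A of 5, of the decomp-qadv lens-6 g23 node «TransferDial» (`Theses/TransferDial.lean` rev 3, sha256
1b7fda5a…95ba; declaration bodies copied verbatim, namespace `…Theses.TransferDial` ↦ `…Theorems.TransferDial`).
Residual mode beneath `Theses.CharDial.FrobLiftOdd` (stmt 32599): the target `StructureLawTwoOdd` = lens-6 g20 piece B.
0 sorry; no `instance`, no `notation`, no `native_decide`.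
-/

set_option autoImplicit false
set_option linter.dupNamespace false

namespace Summit.QuantumAdvantage.QuantumAdvantage.Theorems.TransferDial

open Classical
open Finset Module
open Summit.QuantumAdvantage.AdviceFreeQNC0
open Literature.Computability.MetaComplexity Literature.Computability.MetaComplexity.Smolensky

/-! ## §4 Kernel: BOOLEANITY KILLS THE SECOND DIGIT — a big exchangeable block is `p`-periodic at degree `≤ 2p − 3` -/

section Shadow
variable {p : ℕ} [hp : Fact p.Prime]

/-- One base-`p` digit of Lucas, read in `𝔽_p` (Mathlib `Choose.choose_modEq_choose_mod_mul_choose_div_nat`). -/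
theorem cast_choose_lucas (w e : ℕ) :
    ((w.choose e : ℕ) : ZMod p) = (((w % p).choose (e % p) : ℕ) : ZMod p) * (((w / p).choose (e / p) : ℕ) : ZMod p) := by
  rw [← Nat.cast_mul]
  exact (ZMod.natCast_eq_natCast_iff _ _ _).2 Choose.choose_modEq_choose_mod_mul_choose_div_nat

/-- If the `N`-th difference of `g` vanishes on `[0, L − N]`, all differences of order `N ≤ k ≤ L` vanish at `0`. -/
theorem fwdDiff_iter_zero_of_le (g : ℕ → ZMod p) (N L k : ℕ) (hN : ∀ w, w + N ≤ L → (Nat.iterate (fwdDiff (1 : ℕ)) (N)) g w = 0)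
    (hk : N ≤ k) (hkL : k ≤ L) : (Nat.iterate (fwdDiff (1 : ℕ)) (k)) g 0 = 0 := by
  obtain ⟨j, rfl⟩ := Nat.exists_eq_add_of_le hk
  rw [add_comm, Function.iterate_add_apply, fwdDiff_iter_eq_sum_shift]
  refine Finset.sum_eq_zero fun i hi => ?_
  rw [Finset.mem_range] at hi
  have h0 : ((Nat.iterate (fwdDiff (1 : ℕ)) (N)) g) (0 + i • 1) = 0 := by
    rw [zero_add, smul_eq_mul, mul_one]
    exact hN i (by omega)
  rw [h0, smul_zero]

/-- Gregory–Newton with vanishing high differences: `g w = Σ_{k<N} C(w,k)·Δ^k g(0)` for `w ≤ L`. -/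
theorem newton_trunc (g : ℕ → ZMod p) (N L : ℕ) (hN : ∀ w, w + N ≤ L → (Nat.iterate (fwdDiff (1 : ℕ)) (N)) g w = 0)
    (w : ℕ) (hw : w ≤ L) :
    g w = ∑ k ∈ range N, ((w.choose k : ℕ) : ZMod p) * (Nat.iterate (fwdDiff (1 : ℕ)) (k)) g 0 := by
  have h := shift_eq_sum_fwdDiff_iter (h := (1 : ℕ)) g w 0
  rw [zero_add, smul_eq_mul, mul_one] at h
  rw [h]
  have e1 : ∑ k ∈ range (w + 1), w.choose k • (Nat.iterate (fwdDiff (1 : ℕ)) (k)) g 0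
      = ∑ k ∈ range (w + 1), ((w.choose k : ℕ) : ZMod p) * (Nat.iterate (fwdDiff (1 : ℕ)) (k)) g 0 :=
    Finset.sum_congr rfl fun k _ => by rw [nsmul_eq_mul]
  rw [e1]
  have big1 : ∑ k ∈ range (w + 1), ((w.choose k : ℕ) : ZMod p) * (Nat.iterate (fwdDiff (1 : ℕ)) (k)) g 0
      = ∑ k ∈ range (w + 1 + N), ((w.choose k : ℕ) : ZMod p) * (Nat.iterate (fwdDiff (1 : ℕ)) (k)) g 0 := by
    refine Finset.sum_subset (fun k hk => mem_range.2 (by rw [mem_range] at hk; omega)) ?_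
    intro k _ hk'
    rw [mem_range, not_lt] at hk'
    rw [Nat.choose_eq_zero_of_lt (by omega), Nat.cast_zero, zero_mul]
  have big2 : ∑ k ∈ range N, ((w.choose k : ℕ) : ZMod p) * (Nat.iterate (fwdDiff (1 : ℕ)) (k)) g 0
      = ∑ k ∈ range (w + 1 + N), ((w.choose k : ℕ) : ZMod p) * (Nat.iterate (fwdDiff (1 : ℕ)) (k)) g 0 := by
    refine Finset.sum_subset (fun k hk => mem_range.2 (by rw [mem_range] at hk; omega)) ?_
    intro k hk hk'
    rw [mem_range] at hk
    rw [mem_range, not_lt] at hk'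
    by_cases hkw : w < k
    · rw [Nat.choose_eq_zero_of_lt hkw, Nat.cast_zero, zero_mul]
    · rw [fwdDiff_iter_zero_of_le g N L k hN hk' (by omega), mul_zero]
  rw [big1, big2]

/-- The FIRST-DIGIT part `A(r) = Σ_{k<p} C(r,k) Δ^k g(0)` … -/
noncomputable def dA (g : ℕ → ZMod p) (r : ℕ) : ZMod p :=
  ∑ k ∈ range p, ((r.choose k : ℕ) : ZMod p) * (Nat.iterate (fwdDiff (1 : ℕ)) (k)) g 0

/-- … and the SECOND-DIGIT coefficient `B(r) = Σ_{k<p−2} C(r,k) Δ^{p+k} g(0)`. -/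
noncomputable def dB (g : ℕ → ZMod p) (r : ℕ) : ZMod p :=
  ∑ k ∈ range (p - 2), ((r.choose k : ℕ) : ZMod p) * (Nat.iterate (fwdDiff (1 : ℕ)) (p + k)) g 0

/-- TWO-DIGIT SHADOW of a sequence of «degree `≤ 2p − 3`»: `g(w) = A(w mod p) + ⌊w/p⌋ · B(w mod p)` (Newton + Lucas). -/
theorem two_digit (hp3 : 3 ≤ p) (g : ℕ → ZMod p) (L : ℕ)
    (hN : ∀ w, w + (2 * p - 2) ≤ L → (Nat.iterate (fwdDiff (1 : ℕ)) (2 * p - 2)) g w = 0) (w : ℕ) (hw : w ≤ L) :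
    g w = dA g (w % p) + ((w / p : ℕ) : ZMod p) * dB g (w % p) := by
  have hp0 : 0 < p := by omega
  rw [newton_trunc g (2 * p - 2) L hN w hw]
  have hsplit : 2 * p - 2 = p + (p - 2) := by omega
  rw [hsplit, Finset.sum_range_add]
  congr 1
  · unfold dA
    refine Finset.sum_congr rfl fun k hk => ?_
    rw [mem_range] at hk
    rw [cast_choose_lucas w k, Nat.mod_eq_of_lt hk, Nat.div_eq_of_lt hk, Nat.choose_zero_right, Nat.cast_one, mul_one]
  · unfold dB
    rw [Finset.mul_sum]
    refine Finset.sum_congr rfl fun k hk => ?_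
    rw [mem_range] at hk
    have hkp : k < p := by omega
    have m1 : (p + k) % p = k := by rw [Nat.add_comm, Nat.add_mod_right, Nat.mod_eq_of_lt hkp]
    have d1 : (p + k) / p = 1 := by rw [Nat.add_comm, Nat.add_div_right k hp0, Nat.div_eq_of_lt hkp]
    rw [cast_choose_lucas w (p + k), m1, d1, Nat.choose_one_right]
    ring

/-- `2 ≠ 0` in `ZMod p` for `p ≥ 3`. -/
theorem two_ne_zero_of_three_le (hp3 : 3 ≤ p) : (2 : ZMod p) ≠ 0 := by
  intro h
  have h' : ((2 : ℕ) : ZMod p) = 0 := by exact_mod_cast h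
  rw [ZMod.natCast_eq_zero_iff] at h'
  have := Nat.le_of_dvd (by norm_num) h'
  omega

/-- BOOLEANITY KILLS THE SECOND DIGIT: `a, a + b, a + 2b ∈ {0,1} ⊂ 𝔽_p`, `p ≥ 3` ⟹ `b = 0`. -/
theorem second_digit_zero (hp3 : 3 ≤ p) {a b : ZMod p}
    (h0 : a = 0 ∨ a = 1) (h1 : a + b = 0 ∨ a + b = 1) (h2 : a + 2 * b = 0 ∨ a + 2 * b = 1) : b = 0 := by
  have h2ne0 := two_ne_zero_of_three_le hp3
  have h1ne0 : (1 : ZMod p) ≠ 0 := one_ne_zero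
  rcases h0 with rfl | rfl
  · rcases h1 with h1 | h1
    · linear_combination h1
    · have hb : b = 1 := by linear_combination h1
      subst hb
      rcases h2 with h2 | h2
      · exact absurd (by linear_combination h2) h2ne0
      · exact absurd (by linear_combination h2) h1ne0
  · rcases h1 with h1 | h1
    · have hb : b = -1 := by linear_combination h1
      subst hb
      rcases h2 with h2 | h2
      · exact absurd (by linear_combination -h2) h1ne0
      · exact absurd (by linear_combination -h2) h2ne0
    · linear_combination h1

/-- ★ SEQUENCE FORM: a `{0,1}`-valued sequence on `[0, L]`, `L ≥ 3p − 1`, whose `(2p−2)`-th difference vanishes, is `p`-periodic. -/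
theorem seq_periodic (hp3 : 3 ≤ p) (g : ℕ → ZMod p) (L : ℕ) (hL : 3 * p - 1 ≤ L)
    (hbool : ∀ w, w ≤ L → g w = 0 ∨ g w = 1)
    (hN : ∀ w, w + (2 * p - 2) ≤ L → (Nat.iterate (fwdDiff (1 : ℕ)) (2 * p - 2)) g w = 0) :
    ∀ w, w ≤ L → g w = g (w % p) := by
  intro w hw
  have hp0 : 0 < p := by omega
  have hrp : w % p < p := Nat.mod_lt w hp0
  have base : ∀ r, r < p → g r = dA g r := by
    intro r hr
    have e0 := two_digit hp3 g L hN r (by omega)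
    rw [Nat.mod_eq_of_lt hr, Nat.div_eq_of_lt hr, Nat.cast_zero, zero_mul, add_zero] at e0
    exact e0
  have hB : ∀ r, r < p → dB g r = 0 := by
    intro r hr
    have e1 := two_digit hp3 g L hN (r + p) (by omega)
    have e2 := two_digit hp3 g L hN (r + 2 * p) (by omega)
    have m1 : (r + p) % p = r := by rw [Nat.add_mod_right, Nat.mod_eq_of_lt hr]
    have d1 : (r + p) / p = 1 := by rw [Nat.add_div_right r hp0, Nat.div_eq_of_lt hr]
    have m2 : (r + 2 * p) % p = r := by rw [Nat.add_mul_mod_self_right, Nat.mod_eq_of_lt hr]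
    have d2 : (r + 2 * p) / p = 2 := by rw [Nat.add_mul_div_right r 2 hp0, Nat.div_eq_of_lt hr]
    rw [m1, d1, Nat.cast_one, one_mul] at e1
    rw [m2, d2, Nat.cast_two] at e2
    refine second_digit_zero hp3 (a := dA g r) (b := dB g r) ?_ ?_ ?_
    · rw [← base r hr]; exact hbool r (by omega)
    · rw [← e1]; exact hbool _ (by omega)
    · rw [← e2]; exact hbool _ (by omega)
  rw [two_digit hp3 g L hN w hw, hB _ hrp, mul_zero, add_zero, base _ hrp]

/-- ★★ KERNEL (T2)+(T3) of NODE §2 — the BLOCK SHADOW: at degree `≤ 2p − 3` (`p ≥ 3`) a block of `≥ 3p − 1` pairwise exchangeable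
coordinates is seen only through its weight MOD `p`.  (Degree `≤ p − 1`: the tree's `SubChar.block_periodic`, first Lucas digit only;
one notch up the second digit `⌊w/p⌋` appears linearly and is killed by the three values `A, A+B, A+2B ∈ {0,1}`.) -/
theorem block_periodic_two (hp3 : 3 ≤ p) {n : ℕ} {f : (Fin n → Bool) → Bool} (hf : HasDegF p f (2 * p - 3))
    (X : Finset (Fin n)) (hX : 3 * p - 1 ≤ X.card)
    (hswap : ∀ u : Fin n → Bool, ∀ i ∈ X, ∀ j ∈ X, f (u ∘ Equiv.swap i j) = f u) :
    ∀ u v : Fin n → Bool, (∀ k, k ∉ X → u k = v k) → SubChar.bw X u % p = SubChar.bw X v % p → f u = f v := by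
  intro u v huv hmod
  have hsymm := SubChar.symm_of_swap_invariant f hswap
  -- base point: `u` with the block zeroed
  let x : Fin n → Bool := fun k => if k ∈ X then false else u k
  have hxX : ∀ k ∈ X, x k = false := fun k hk => by simp [x, hk]
  have hxout : ∀ k, k ∉ X → x k = u k := fun k hk => by simp [x, hk]
  have hbwx : SubChar.bw X x = 0 := by
    unfold SubChar.bw
    rw [Finset.card_eq_zero, filter_eq_empty_iff]
    intro k hk
    simp [hxX k hk]
  have hT : ∀ t, t ≤ X.card → ∃ T, T ⊆ X ∧ T.card = t := fun t ht => by
    obtain ⟨T, hTX, hTc⟩ := Finset.exists_subset_card_eq ht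
    exact ⟨T, hTX, hTc⟩
  -- the layer profile of `f` above `x` along `X`
  let g : ℕ → ZMod p := fun t =>
    if h : t ≤ X.card then SubLog.indR (ZMod p) f (SubChar.setOn (Classical.choose (hT t h)) x) else 0
  have hbool : ∀ t, t ≤ X.card → g t = 0 ∨ g t = 1 := by
    intro t ht
    simp only [g, dif_pos ht, SubLog.indR]
    cases f _ <;> simp
  -- agreement outside `X` with `u` ⟹ the indicator is the profile at the block weight
  have hg : ∀ w : Fin n → Bool, (∀ k, k ∉ X → w k = u k) → SubLog.indR (ZMod p) f w = g (SubChar.bw X w) := by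
    intro w hw
    have ht : SubChar.bw X w ≤ X.card := card_filter_le _ _
    simp only [g, dif_pos ht]
    have hTs := Classical.choose_spec (hT _ ht)
    have hfw : f w = f (SubChar.setOn (Classical.choose (hT _ ht)) x) := by
      apply hsymm
      · intro k hk
        have hkT : k ∉ Classical.choose (hT _ ht) := fun h => hk (hTs.1 h)
        rw [hw k hk]
        simp [SubChar.setOn, hkT, hxout k hk]
      · rw [SubChar.bw_setOn (fun i hi => hxX i (hTs.1 hi)), hbwx, zero_add, inter_eq_left.2 hTs.1, hTs.2]
    simp only [SubLog.indR, hfw]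
  -- the `(2p−2)`-th difference of the profile vanishes: it is a Möbius coefficient of order `2p − 2 > deg`
  have hN : ∀ w₀, w₀ + (2 * p - 2) ≤ X.card → (Nat.iterate (fwdDiff (1 : ℕ)) (2 * p - 2)) g w₀ = 0 := by
    intro w₀ hw₀
    obtain ⟨T₀, hT₀X, hT₀c⟩ := hT w₀ (by omega)
    let x' : Fin n → Bool := SubChar.setOn T₀ x
    have hx'out : ∀ k, k ∉ X → x' k = u k := by
      intro k hk
      have hkT : k ∉ T₀ := fun h => hk (hT₀X h)
      simp [x', SubChar.setOn, hkT, hxout k hk]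
    have hbwx' : SubChar.bw X x' = w₀ := by
      show SubChar.bw X (SubChar.setOn T₀ x) = w₀
      rw [SubChar.bw_setOn (fun i hi => hxX i (hT₀X hi)), hbwx, zero_add, inter_eq_left.2 hT₀X, hT₀c]
    have hcard : 2 * p - 2 ≤ (X \ T₀).card := by rw [card_sdiff_of_subset hT₀X]; omega
    obtain ⟨Y, hYX, hYc⟩ := Finset.exists_subset_card_eq hcard
    have hYX' : Y ⊆ X := fun i hi => (mem_sdiff.1 (hYX hi)).1
    have hx'Y : ∀ i ∈ Y, x' i = false := by
      intro i hi
      have h := mem_sdiff.1 (hYX hi)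
      simp [x', SubChar.setOn, h.2, hxX i h.1]
    -- values on the subcube above `x'` along `Y`
    have hval : ∀ T ∈ Y.powerset, (-1 : ZMod p) ^ (Y.card - T.card) *
        SubLog.indR (ZMod p) (fun w => f (SubChar.overOn Y x' w)) (SubLog.vert T)
        = (fun t : ℕ => (-1 : ZMod p) ^ (2 * p - 2 - t) * g (w₀ + t)) T.card := by
      intro T hTY
      rw [mem_powerset] at hTY
      have hTx' : ∀ i ∈ T, x' i = false := fun i hi => hx'Y i (hTY hi)
      have e1 : SubLog.indR (ZMod p) (fun w => f (SubChar.overOn Y x' w)) (SubLog.vert T)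
          = SubLog.indR (ZMod p) f (SubChar.setOn T x') := by
        simp only [SubLog.indR, SubChar.overOn_vert hTY hx'Y]
      have e2 : SubChar.bw X (SubChar.setOn T x') = w₀ + T.card := by
        rw [SubChar.bw_setOn hTx', hbwx', inter_eq_left.2 (hTY.trans hYX')]
      have e3 : ∀ k, k ∉ X → SubChar.setOn T x' k = u k := by
        intro k hk
        have hkT : k ∉ T := fun h => hk (hYX' (hTY h))
        simp only [SubChar.setOn, hkT, if_false, hx'out k hk]
      dsimp only
      rw [e1, hg _ e3, e2, hYc]
    have hmoeb : SubLog.moeb (SubLog.indR (ZMod p) (fun w => f (SubChar.overOn Y x' w))) Y = 0 :=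
      SubLog.moeb_eq_zero_of_mem_lowDeg ((SubLog.hasDegF_iff_indR p _ _).1 (SubChar.hasDegF_overOn p Y x' hf))
        (by rw [hYc]; omega)
    have hsum : SubLog.moeb (SubLog.indR (ZMod p) (fun w => f (SubChar.overOn Y x' w))) Y
        = ∑ t ∈ range (2 * p - 2 + 1), (2 * p - 2).choose t • ((-1 : ZMod p) ^ (2 * p - 2 - t) * g (w₀ + t)) := by
      unfold SubLog.moeb
      rw [Finset.sum_congr rfl hval,
        Finset.sum_powerset_apply_card (fun t : ℕ => (-1 : ZMod p) ^ (2 * p - 2 - t) * g (w₀ + t)), hYc]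
    rw [fwdDiff_iter_eq_sum_shift, ← hmoeb, hsum]
    refine Finset.sum_congr rfl fun k _ => ?_
    simp only [zsmul_eq_mul, nsmul_eq_mul, smul_eq_mul, mul_one]
    push_cast
    ring
  -- conclude by the sequence form
  have hper := seq_periodic hp3 g X.card hX hbool hN
  have hu := hg u (fun k _ => rfl)
  have hv := hg v (fun k hk => (huv k hk).symm)
  have hbu : SubChar.bw X u ≤ X.card := card_filter_le _ _
  have hbv : SubChar.bw X v ≤ X.card := card_filter_le _ _
  have hind : SubLog.indR (ZMod p) f u = SubLog.indR (ZMod p) f v := by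
    rw [hu, hv, hper _ hbu, hper _ hbv, hmod]
  simp only [SubLog.indR] at hind
  have h10 : (1 : ZMod p) ≠ 0 := one_ne_zero
  cases hfu : f u <;> cases hfv : f v <;> simp_all

/-- The block of a block map. -/
noncomputable def blockOf {m r : ℕ} (b : Fin m → Option (Fin r)) (i : Fin r) : Finset (Fin m) :=
  univ.filter fun k => b k = some i

/-- Membership in the block of a block map. -/
theorem mem_blockOf {m r : ℕ} (b : Fin m → Option (Fin r)) (i : Fin r) (k : Fin m) : k ∈ blockOf b i ↔ b k = some i := by
  simp [blockOf]

/-- ★★ KERNEL — THE SHADOW (NODE §2 (3)): a cut of degree `≤ 2p − 3` that is symmetric inside each used block of a block map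
(blocks `≥ 3p − 1`) depends only on the free coordinates and on the block weights MOD `p`. -/
theorem shadow_blocks (hp3 : 3 ≤ p) {m r : ℕ} {f : (Fin m → Bool) → Bool} (hf : HasDegF p f (2 * p - 3))
    (b : Fin m → Option (Fin r))
    (hsw : ∀ i k, b i = b k → b i ≠ none → ∀ u : Fin m → Bool, f (u ∘ Equiv.swap i k) = f u)
    (hbig : ∀ i, b i ≠ none → 3 * p - 1 ≤ (univ.filter fun k : Fin m => b k = b i).card) :
    ∀ u v : Fin m → Bool, (∀ k, b k = none → u k = v k) →
      (∀ i : Fin r, SubChar.bw (blockOf b i) u % p = SubChar.bw (blockOf b i) v % p) → f u = f v := by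
  intro u v hfree hmod
  -- hybrid inputs: `v` on the blocks in `S`, `u` elsewhere
  let hyb : Finset (Fin r) → (Fin m → Bool) := fun S k => if ∃ i ∈ S, b k = some i then v k else u k
  have hyb_empty : hyb ∅ = u := by
    funext k; simp [hyb]
  have hyb_univ : hyb univ = v := by
    funext k
    simp only [hyb]
    by_cases hk : b k = none
    · rw [if_neg (by simp [hk]), hfree k hk]
    · obtain ⟨i, hi⟩ := Option.ne_none_iff_exists'.1 hk
      rw [if_pos ⟨i, mem_univ _, hi⟩]
  -- one block at a time
  have step : ∀ (i : Fin r) (S : Finset (Fin r)), i ∉ S → f (hyb (insert i S)) = f (hyb S) := by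
    intro i S hiS
    by_cases hused : ∃ k, b k = some i
    · obtain ⟨k₀, hk₀⟩ := hused
      have hX : 3 * p - 1 ≤ (blockOf b i).card := by
        have h := hbig k₀ (by simp [hk₀])
        rw [hk₀] at h
        exact h
      have hswapX : ∀ w : Fin m → Bool, ∀ a ∈ blockOf b i, ∀ c ∈ blockOf b i, f (w ∘ Equiv.swap a c) = f w := by
        intro w a ha c hc
        rw [mem_blockOf] at ha hc
        exact hsw a c (by rw [ha, hc]) (by simp [ha]) w
      refine block_periodic_two hp3 hf (blockOf b i) hX hswapX _ _ ?_ ?_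
      · intro k hk
        rw [mem_blockOf] at hk
        simp only [hyb, mem_insert]
        by_cases h1 : ∃ j ∈ S, b k = some j
        · obtain ⟨j, hj, hbj⟩ := h1
          rw [if_pos ⟨j, Or.inr hj, hbj⟩, if_pos ⟨j, hj, hbj⟩]
        · rw [if_neg h1, if_neg]
          rintro ⟨j, hj | hj, hbj⟩
          · exact hk (hj ▸ hbj)
          · exact h1 ⟨j, hj, hbj⟩
      · -- weights on the block: `hyb (insert i S)` is `v` there, `hyb S` is `u` there
        have e1 : SubChar.bw (blockOf b i) (hyb (insert i S)) = SubChar.bw (blockOf b i) v := by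
          unfold SubChar.bw
          congr 1
          refine filter_congr fun k hk => ?_
          rw [mem_blockOf] at hk
          simp only [hyb]
          rw [if_pos ⟨i, mem_insert_self i S, hk⟩]
        have e2 : SubChar.bw (blockOf b i) (hyb S) = SubChar.bw (blockOf b i) u := by
          unfold SubChar.bw
          congr 1
          refine filter_congr fun k hk => ?_
          rw [mem_blockOf] at hk
          simp only [hyb]
          rw [if_neg]
          rintro ⟨j, hj, hbj⟩
          rw [hk] at hbj
          exact hiS ((Option.some.inj hbj) ▸ hj)
        rw [e1, e2, hmod i]
    · -- unused block index: the two hybrids coincide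
      have : hyb (insert i S) = hyb S := by
        funext k
        simp only [hyb, mem_insert]
        by_cases h1 : ∃ j ∈ S, b k = some j
        · obtain ⟨j, hj, hbj⟩ := h1
          rw [if_pos ⟨j, Or.inr hj, hbj⟩, if_pos ⟨j, hj, hbj⟩]
        · rw [if_neg h1, if_neg]
          rintro ⟨j, hj | hj, hbj⟩
          · exact hused ⟨k, hj ▸ hbj⟩
          · exact h1 ⟨j, hj, hbj⟩
      rw [this]
  have all : ∀ S : Finset (Fin r), f (hyb S) = f u := by
    intro S
    induction S using Finset.induction_on with
    | empty => rw [hyb_empty]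
    | insert i S hiS ih => rw [step i S hiS, ih]
  rw [← hyb_univ, all univ]


end Shadow

end Summit.QuantumAdvantage.QuantumAdvantage.Theorems.TransferDial
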